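import Summits.CriticalPhenomena.PercolationContinuityZ3.Theorems.Transplant.PlanarSkeletonSignDefs
import HarnessLib

/-!
# The `nbo` net in geometric coordinates: its `(y,z)`-chart is SIGN-COMPLETE (inversion-type `−I` and both axis flips through EVERY vertex are
# automorphisms), 1-Lipschitz, translated by the bcc frames (three types) — and the outward unit steps that single edges cannot supply
# (`Nbo.isEmpty_planarSkeletonSign`, gen 19) are supplied by 2-PATHS whose first edge is chart-NEUTRAL (kernel placement certificate, no node)

builds on p205010 (kernel theorem, internal audit signed; external expert review pending) — nothing in this file uses p205010; NOTHING is claimed about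
`θ_{nbo}(p_c)` nor about any node.  Lane `prim-bschramm`, seat `prim-bschramm-p4` (gen 20; PART C3, `HOME/bschramm/P4-GENERAL.md` §42.4).  Helper file
(`--supports stmt-CriticalPhenomena-4575 --as helper`).

WHY.  Gen 19 proved that nbo carries NO chart with single-edge unit steps (`NboNetNoSkeleton`, all charts), placing it on the multi-type wall with the
verdict "(M)+(Q): needs quasi-steps".  This file makes the POSITIVE half exact, so that the planner knows precisely which relaxation of the CLOSED
`(ℤ/2)²` node nbo is waiting for: in the geometric integer model (`x ∈ sites` ⟺ the three coordinates of `x ∈ ℤ³` do NOT all have the same parity;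
nearest-neighbour bonds) the projection chart `chart x = (x₁, x₂)` is 1-Lipschitz (`lip`); the reflections `x ↦ ε • (x − p) + p` through ANY lattice
point `p` (`reflIso`) are automorphisms, so at every vertex the half-turn about the `x`-parallel axis acts by `−I` and the mirrors `z ↦ 2p₂ − z`,
`y ↦ 2p₁ − y` by `flipSnd`, `flipFst` on the relative chart (`exists_neg`, `exists_flipSnd`, `exists_flipFst`) — the point group of
`PlanarSkeletonSign` at EVERY vertex; the translations by vectors with three coordinates of equal parity (the bcc lattice) are chart-translating frames
with three base vertices `e₀, e₁, e₂` (`shiftIso`, `exists_frame`); and at every vertex, for every chart direction, there is either a single edge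
realising the unit step or a 2-PATH whose first edge does not move the chart (`qstep`).  So nbo is a customer of "D″ with one chart-neutral edge
allowed before each outward step" (scale `N = 1`) — the mildest conceivable relaxation of (ι); no such node is typed ((A4); design owner's call).
(κ) (connected cylinders) is routine here — fibres are coordinate lines joined within chart distance `1` — checked numerically in the seat
(`HOME/prim-bschramm-p4-g20/lean/nbo_check.py`), not typed in this file.  The identification with g19's `TableNet` model `Nbo.graph` is R-level
(same net, bcc cell `(2,0,0),(0,2,0),(1,1,1)`, three classes = special axis).
* §1 `sites`, `units3`, `graph`, `adj_iff`, local finiteness; §2 `refl`/`reflIso` (all sign reflections through lattice points), `shiftIso` (bcc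
  translations), `exists_frame`; §3 `chart`, `lip`, `exists_neg/flipSnd/flipFst`; §4 `qstep_base` (12 explicit cases), **`qstep`** (every vertex).
[cite: ConwaySloane1999, Ch. 4 §7.1 (cubic lattices and their sublattices)] [cite: KozmaNitzan2024, §4 p. 15 (outward steps), p. 16 (Lemma 8)]
-/

noncomputable section

namespace Summit.CriticalPhenomena.PercolationContinuityZ3.Theorems.Transplant

open SimpleGraph Literature.Probability.LatticeModels Literature.Probability.Percolation
open scoped Classical

namespace NboZ3

/-! ## §1 The net: sites = integer points whose coordinates are NOT all of the same parity; nearest-neighbour bonds -/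

/-- `x ∈ ℤ³` is a site of nbo iff its three coordinates do not all have the same parity (exactly one or exactly two are odd). [cite: ConwaySloane1999, Ch. 4 §7.1] -/
def sites : Set (Site 3) := {x | ¬(x 0 % 2 = x 1 % 2 ∧ x 1 % 2 = x 2 % 2)}

/-- Membership in `sites` is decidable (by its definition). [folklore] -/
instance sites_decidable (x : Site 3) : Decidable (x ∈ sites) :=
  inferInstanceAs (Decidable (¬(x 0 % 2 = x 1 % 2 ∧ x 1 % 2 = x 2 % 2)))

/-- The six signed unit vectors of `ℤ³`. [folklore] -/
def units3 : Finset (Site 3) := {![1, 0, 0], ![-1, 0, 0], ![0, 1, 0], ![0, -1, 0], ![0, 0, 1], ![0, 0, -1]}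

/-- Membership in `units3` = `ℓ¹`-norm one. [folklore] -/
theorem mem_units3_iff (v : Site 3) : v ∈ units3 ↔ |v 0| + |v 1| + |v 2| = 1 := by
  constructor
  · intro h
    simp only [units3, Finset.mem_insert, Finset.mem_singleton] at h
    rcases h with rfl | rfl | rfl | rfl | rfl | rfl <;> simp
  · intro h
    have e : v = ![v 0, v 1, v 2] := by funext i; fin_cases i <;> rfl
    have a0 := le_abs_self (v 0); have b0 := neg_abs_le (v 0); have c0 := abs_nonneg (v 0)
    have a1 := le_abs_self (v 1); have b1 := neg_abs_le (v 1); have c1 := abs_nonneg (v 1)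
    have a2 := le_abs_self (v 2); have b2 := neg_abs_le (v 2); have c2 := abs_nonneg (v 2)
    have h0 : v 0 = 0 ∨ v 0 = 1 ∨ v 0 = -1 := by omega
    have h1 : v 1 = 0 ∨ v 1 = 1 ∨ v 1 = -1 := by omega
    have h2 : v 2 = 0 ∨ v 2 = 1 ∨ v 2 = -1 := by omega
    rw [e]
    rcases h0 with h0 | h0 | h0 <;> rcases h1 with h1 | h1 | h1 <;> rcases h2 with h2 | h2 | h2 <;>
      simp only [h0, h1, h2, abs_zero, abs_one, abs_neg] at h ⊢ <;> first | decide | omega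

/-- `units3` is symmetric. [folklore] -/
theorem neg_mem_units3 {v : Site 3} (h : v ∈ units3) : -v ∈ units3 := by
  rw [mem_units3_iff] at h ⊢; simpa using h

/-- `0 ∉ units3`. [folklore] -/
theorem zero_notMem_units3 : (0 : Site 3) ∉ units3 := by decide

/-- **The nbo net** (geometric model): nearest-neighbour bonds between sites.  (The graph is declared on all of `ℤ³`; the non-sites — points with
three coordinates of the same parity — are ISOLATED vertices and every statement of this file is about sites.) [cite: ConwaySloane1999, Ch. 4 §7.1] -/
def graph : SimpleGraph (Site 3) := SimpleGraph.fromRel fun x y => x ∈ sites ∧ y ∈ sites ∧ y - x ∈ units3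

/-- Adjacency. [folklore] -/
theorem adj_iff (x y : Site 3) : graph.Adj x y ↔ x ∈ sites ∧ y ∈ sites ∧ y - x ∈ units3 := by
  rw [graph, SimpleGraph.fromRel_adj]
  constructor
  · rintro ⟨-, h | ⟨hy, hx, h⟩⟩
    · exact h
    · exact ⟨hx, hy, by rw [← neg_sub]; exact neg_mem_units3 h⟩
  · intro h
    refine ⟨fun hxy => zero_notMem_units3 ?_, Or.inl h⟩
    subst hxy; simpa using h.2.2

/-- The neighbours of `x` are among the `x + v`, `v ∈ units3`. [folklore] -/
theorem neighborSet_subset (x : Site 3) : graph.neighborSet x ⊆ ↑(units3.image (x + ·)) := by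
  intro y hy
  rw [SimpleGraph.mem_neighborSet, adj_iff] at hy
  rw [Finset.coe_image]
  exact ⟨y - x, Finset.mem_coe.2 hy.2.2, by abel⟩

/-- The nbo net is locally finite. [folklore] -/
noncomputable instance graph_locallyFinite : graph.LocallyFinite := fun x =>
  ((Finset.finite_toSet _).subset (neighborSet_subset x)).fintype

/-! ## §2 Automorphisms: sign reflections through lattice points, bcc translations; frames -/

/-- The sign reflection `x ↦ ε • (x − p) + p` through the lattice point `p`. [folklore] -/
def refl (p : Site 3) (ε : Fin 3 → ℤˣ) (x : Site 3) : Site 3 := fun i => (ε i : ℤ) * (x i - p i) + p i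

/-- `refl p ε` is an involution. [folklore] -/
theorem refl_refl (p : Site 3) (ε : Fin 3 → ℤˣ) (x : Site 3) : refl p ε (refl p ε x) = x := by
  funext i
  simp only [refl, add_sub_cancel_right]
  rcases Int.units_eq_one_or (ε i) with h | h <;> simp [h]

/-- `refl p ε` fixes `p`. [folklore] -/
theorem refl_self (p : Site 3) (ε : Fin 3 → ℤˣ) : refl p ε p = p := by
  funext i; simp [refl]

/-- Differences transform by the signs. [folklore] -/
theorem refl_sub (p : Site 3) (ε : Fin 3 → ℤˣ) (x y : Site 3) : refl p ε y - refl p ε x = fun i => (ε i : ℤ) * (y - x) i := by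
  funext i; simp only [refl, Pi.sub_apply]; ring

/-- Sign reflections through lattice points preserve coordinate parities. [folklore] -/
theorem refl_mod_two (p : Site 3) (ε : Fin 3 → ℤˣ) (x : Site 3) (i : Fin 3) : refl p ε x i % 2 = x i % 2 := by
  simp only [refl]
  rcases Int.units_eq_one_or (ε i) with h | h <;> simp only [h, Units.val_one, Units.val_neg] <;> omega

/-- Hence they preserve the site set. [folklore] -/
theorem isSite_refl (p : Site 3) (ε : Fin 3 → ℤˣ) (x : Site 3) : refl p ε x ∈ sites ↔ x ∈ sites := by
  simp only [sites, Set.mem_setOf_eq, refl_mod_two]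

/-- Signed unit vectors stay signed unit vectors. [folklore] -/
theorem smul_mem_units3_iff (ε : Fin 3 → ℤˣ) (v : Site 3) : (fun i => (ε i : ℤ) * v i) ∈ units3 ↔ v ∈ units3 := by
  have habs : ∀ i, |(ε i : ℤ) * v i| = |v i| := fun i => by
    rcases Int.units_eq_one_or (ε i) with h | h <;> simp [h]
  rw [mem_units3_iff, mem_units3_iff, habs, habs, habs]

/-- **Every sign reflection through a lattice point is an automorphism of nbo** (inversions, axis half-turns, coordinate mirrors).
[cite: KozmaNitzan2024, §4 p. 16 (Lemma 8: the lattice symmetries)] -/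
def reflIso (p : Site 3) (ε : Fin 3 → ℤˣ) : graph ≃g graph where
  toFun := refl p ε
  invFun := refl p ε
  left_inv := refl_refl p ε
  right_inv := refl_refl p ε
  map_rel_iff' := by
    intro x y
    simp only [Equiv.coe_fn_mk, adj_iff, isSite_refl, refl_sub, smul_mem_units3_iff]

/-- `reflIso p ε x = refl p ε x`. [folklore] -/
@[simp] theorem reflIso_apply (p : Site 3) (ε : Fin 3 → ℤˣ) (x : Site 3) : reflIso p ε x = refl p ε x := rfl

/-- A vector whose three coordinates have the same parity (the bcc lattice `(2ℤ)³ ∪ ((2ℤ)³ + (1,1,1))`). [folklore] -/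
def frameVecs : Set (Site 3) := {u | u 0 % 2 = u 1 % 2 ∧ u 1 % 2 = u 2 % 2}

/-- Membership in `frameVecs` is decidable. [folklore] -/
instance frameVecs_decidable (u : Site 3) : Decidable (u ∈ frameVecs) :=
  inferInstanceAs (Decidable (u 0 % 2 = u 1 % 2 ∧ u 1 % 2 = u 2 % 2))

/-- Translation by a bcc vector preserves the site set. [folklore] -/
theorem isSite_add {u : Site 3} (hu : u ∈ frameVecs) (x : Site 3) : x + u ∈ sites ↔ x ∈ sites := by
  obtain ⟨h01, h12⟩ := hu
  simp only [sites, Set.mem_setOf_eq, Pi.add_apply]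
  constructor <;> intro h hc <;> apply h <;> omega

/-- **Translation by a bcc vector is an automorphism.** [folklore] -/
def shiftIso (u : Site 3) (hu : u ∈ frameVecs) : graph ≃g graph where
  toEquiv := Equiv.addRight u
  map_rel_iff' := by
    intro x y
    simp only [Equiv.coe_addRight, adj_iff, isSite_add hu, add_sub_add_right_eq_sub]

/-- `shiftIso u _ x = x + u`. [folklore] -/
@[simp] theorem shiftIso_apply (u : Site 3) (hu : u ∈ frameVecs) (x : Site 3) : shiftIso u hu x = x + u := rfl

/-- The three base vertices `e₀, e₁, e₂` (special axis `x, y, z`). [folklore] -/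
def base (c : Fin 3) : Site 3 := Pi.single c 1

/-- The base vertices are sites. [folklore] -/
theorem isSite_base : ∀ c : Fin 3, base c ∈ sites := by decide

/-- **Frames: every site is a bcc translate of one of the three base vertices.** [cite: KozmaNitzan2024, §4 p. 16 (Lemma 8)] -/
theorem exists_frame (x : Site 3) (hx : x ∈ sites) : ∃ (c : Fin 3) (u : Site 3) (hu : u ∈ frameVecs), shiftIso u hu (base c) = x := by
  simp only [sites, Set.mem_setOf_eq] at hx
  by_cases h01 : x 0 % 2 = x 1 % 2
  · have h12 : x 1 % 2 ≠ x 2 % 2 := fun h => hx ⟨h01, h⟩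
    refine ⟨2, x - base 2, show _ ∧ _ from ⟨?_, ?_⟩, ?_⟩
    · simp [base]; omega
    · simp [base]; omega
    · simp
  · by_cases h12 : x 1 % 2 = x 2 % 2
    · refine ⟨0, x - base 0, show _ ∧ _ from ⟨?_, ?_⟩, ?_⟩
      · simp [base]; omega
      · simp [base]; omega
      · simp
    · refine ⟨1, x - base 1, show _ ∧ _ from ⟨?_, ?_⟩, ?_⟩
      · simp [base]; omega
      · simp [base]; omega
      · simp

/-! ## §3 The `(y,z)` chart: Lipschitz, and the full axis point group `{±1}²` at EVERY vertex -/

/-- The projection chart `x ↦ (x₁, x₂)`. [cite: KozmaNitzan2024, §4 p. 15 (the coordinate map)] -/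
def chart (x : Site 3) : Site 2 := ![x 1, x 2]

/-- `chart` is additive. [folklore] -/
theorem chart_add (x u : Site 3) : chart (x + u) = chart x + chart u := by
  funext j; fin_cases j <;> simp [chart]

/-- `chart` is subtractive. [folklore] -/
theorem chart_sub (x u : Site 3) : chart (x - u) = chart x - chart u := by
  funext j; fin_cases j <;> simp [chart]

/-- **The chart is 1-Lipschitz in the sup-norm along bonds.** [cite: KozmaNitzan2024, §4 p. 15] -/
theorem lip {x y : Site 3} (h : graph.Adj x y) (j : Fin 2) : |chart x j - chart y j| ≤ 1 := by
  have hv := (mem_units3_iff _).1 ((adj_iff x y).1 h).2.2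
  simp only [Pi.sub_apply] at hv
  have ha : ∀ k, 0 ≤ |(y - x) k| := fun k => abs_nonneg _
  fin_cases j
  · show |x 1 - y 1| ≤ 1
    rw [abs_sub_comm]; have := ha 0; have := ha 2; simp only [Pi.sub_apply] at *; omega
  · show |x 2 - y 2| ≤ 1
    rw [abs_sub_comm]; have := ha 0; have := ha 1; simp only [Pi.sub_apply] at *; omega

/-- The relative chart action of a sign reflection: the signs `(ε₁, ε₂)`. [folklore] -/
theorem chart_refl_sub (p : Site 3) (ε : Fin 3 → ℤˣ) (w : Site 3) :
    chart (refl p ε w) - chart p = fun j => (ε j.succ : ℤ) * (chart w - chart p) j := by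
  funext j; fin_cases j <;> simp [chart, refl]

/-- **`−I` at every lattice point**: the half-turn about the `x`-parallel axis through `p` (`ε = (1,−1,−1)`). [cite: KozmaNitzan2024, §4 p. 16 (Lemma 8)] -/
theorem exists_neg (p : Site 3) : ∃ α : graph ≃g graph, α p = p ∧ ∀ w, chart (α w) - chart p = -(chart w - chart p) := by
  refine ⟨reflIso p ![1, -1, -1], refl_self p _, fun w => ?_⟩
  rw [reflIso_apply, chart_refl_sub]
  funext j; fin_cases j <;> simp

/-- **`flipSnd` at every lattice point**: the mirror `z ↦ 2p₂ − z` (`ε = (1,1,−1)`). [cite: KozmaNitzan2024, §4 p. 16 (Lemma 8)] -/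
theorem exists_flipSnd (p : Site 3) : ∃ α : graph ≃g graph, α p = p ∧ ∀ w, chart (α w) - chart p = flipSnd (chart w - chart p) := by
  refine ⟨reflIso p ![1, 1, -1], refl_self p _, fun w => ?_⟩
  rw [reflIso_apply, chart_refl_sub]
  funext j; fin_cases j <;> simp [flipSnd]

/-- **`flipFst` at every lattice point**: the mirror `y ↦ 2p₁ − y` (`ε = (1,−1,1)`). [cite: KozmaNitzan2024, §4 p. 16 (Lemma 8)] -/
theorem exists_flipFst (p : Site 3) : ∃ α : graph ≃g graph, α p = p ∧ ∀ w, chart (α w) - chart p = flipFst (chart w - chart p) := by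
  refine ⟨reflIso p ![1, -1, 1], refl_self p _, fun w => ?_⟩
  rw [reflIso_apply, chart_refl_sub]
  funext j; fin_cases j <;> simp [flipFst]

/-- Frames translate the chart. [folklore] -/
theorem chart_shiftIso (u : Site 3) (hu : u ∈ frameVecs) (x : Site 3) : chart (shiftIso u hu x) = chart x + chart u := by
  rw [shiftIso_apply, chart_add]

/-! ## §4 QUASI-STEPS: every outward unit step is a single edge or a 2-path with a chart-neutral first edge -/

/-- Concrete adjacency from the three decidable facts. [folklore] -/
theorem adj_of (x y : Site 3) (hx : x ∈ sites) (hy : y ∈ sites) (h : y - x ∈ units3) : graph.Adj x y := (adj_iff x y).2 ⟨hx, hy, h⟩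

/-- **Quasi-steps at the base vertices** (12 explicit cases): `e₀` (special axis `x`): all four steps are single edges; `e₁` (special `y`): `±e_z`
single, `±e_y` along `e₁ → e₁ + e_x → e₁ + e_x ± e_y`; `e₂` (special `z`): `±e_y` single, `±e_z` along `e₂ → e₂ + e_x → e₂ + e_x ± e_z`.
[cite: KozmaNitzan2024, §4 p. 15 (outward steps)] -/
theorem qstep_base (c : Fin 3) (j : Fin 2) (σ : ℤˣ) : ∃ y z : Site 3, graph.Adj (base c) y ∧ (z = y ∨ graph.Adj y z) ∧
    (z = y ∨ chart y = chart (base c)) ∧ chart z = chart (base c) + Pi.single j (σ : ℤ) := by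
  fin_cases c <;> fin_cases j <;> rcases Int.units_eq_one_or σ with rfl | rfl
  -- c = 0 : base (1,0,0), all single edges
  · exact ⟨![1, 1, 0], ![1, 1, 0], adj_of _ _ (by decide) (by decide) (by decide), Or.inl rfl, Or.inl rfl, by decide⟩
  · exact ⟨![1, -1, 0], ![1, -1, 0], adj_of _ _ (by decide) (by decide) (by decide), Or.inl rfl, Or.inl rfl, by decide⟩
  · exact ⟨![1, 0, 1], ![1, 0, 1], adj_of _ _ (by decide) (by decide) (by decide), Or.inl rfl, Or.inl rfl, by decide⟩
  · exact ⟨![1, 0, -1], ![1, 0, -1], adj_of _ _ (by decide) (by decide) (by decide), Or.inl rfl, Or.inl rfl, by decide⟩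
  -- c = 1 : base (0,1,0); y-direction via the chart-neutral x-bond, z-direction single
  · exact ⟨![1, 1, 0], ![1, 2, 0], adj_of _ _ (by decide) (by decide) (by decide),
      Or.inr (adj_of _ _ (by decide) (by decide) (by decide)), Or.inr (by decide), by decide⟩
  · exact ⟨![1, 1, 0], ![1, 0, 0], adj_of _ _ (by decide) (by decide) (by decide),
      Or.inr (adj_of _ _ (by decide) (by decide) (by decide)), Or.inr (by decide), by decide⟩
  · exact ⟨![0, 1, 1], ![0, 1, 1], adj_of _ _ (by decide) (by decide) (by decide), Or.inl rfl, Or.inl rfl, by decide⟩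
  · exact ⟨![0, 1, -1], ![0, 1, -1], adj_of _ _ (by decide) (by decide) (by decide), Or.inl rfl, Or.inl rfl, by decide⟩
  -- c = 2 : base (0,0,1); y-direction single, z-direction via the chart-neutral x-bond
  · exact ⟨![0, 1, 1], ![0, 1, 1], adj_of _ _ (by decide) (by decide) (by decide), Or.inl rfl, Or.inl rfl, by decide⟩
  · exact ⟨![0, -1, 1], ![0, -1, 1], adj_of _ _ (by decide) (by decide) (by decide), Or.inl rfl, Or.inl rfl, by decide⟩
  · exact ⟨![1, 0, 1], ![1, 0, 2], adj_of _ _ (by decide) (by decide) (by decide),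
      Or.inr (adj_of _ _ (by decide) (by decide) (by decide)), Or.inr (by decide), by decide⟩
  · exact ⟨![1, 0, 1], ![1, 0, 0], adj_of _ _ (by decide) (by decide) (by decide),
      Or.inr (adj_of _ _ (by decide) (by decide) (by decide)), Or.inr (by decide), by decide⟩

/-- **QUASI-STEPS AT EVERY VERTEX**: for every site `x`, chart direction `j` and sign `σ` there are `y, z` with `x ∼ y`, `z = y` or `y ∼ z`, the
first edge chart-NEUTRAL unless it is already the step, and `chart z = chart x + σ e_j` — a unit step along a path of length `≤ 2` (transport of
`qstep_base` by the frames). [cite: KozmaNitzan2024, §4 p. 15 (outward steps)] -/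
theorem qstep (x : Site 3) (hx : x ∈ sites) (j : Fin 2) (σ : ℤˣ) : ∃ y z : Site 3, graph.Adj x y ∧ (z = y ∨ graph.Adj y z) ∧
    (z = y ∨ chart y = chart x) ∧ chart z = chart x + Pi.single j (σ : ℤ) := by
  obtain ⟨c, u, hu, hxe⟩ := exists_frame x hx
  obtain ⟨y, z, h1, h2, h3, h4⟩ := qstep_base c j σ
  refine ⟨y + u, z + u, ?_, ?_, ?_, ?_⟩
  · have h := (shiftIso u hu).map_rel_iff.2 h1
    rwa [hxe, shiftIso_apply] at h
  · rcases h2 with rfl | h2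
    · exact Or.inl rfl
    · exact Or.inr (by simpa using (shiftIso u hu).map_rel_iff.2 h2)
  · rcases h3 with rfl | h3
    · exact Or.inl rfl
    · refine Or.inr ?_
      rw [← hxe, shiftIso_apply, chart_add, chart_add, h3]
  · rw [← hxe, shiftIso_apply, chart_add, chart_add, h4]; abel

end NboZ3

end Summit.CriticalPhenomena.PercolationContinuityZ3.Theorems.Transplant

end
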